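import Literature.Probability.LatticeModels.IsingMonotonicity
import HarnessLib

/-!
# Finite-volume consistency (DLR) of the Ising measures with a fixed boundary condition

Trunk G02 (T-STATMECH), topic `Probability/LatticeModels`; namespaces `Literature.StatMech`
(any locally finite graph, any fixed boundary condition) and `Literature.CritIsing` (a GKS II
consequence). Theorem-only file (no new definitions, no named facts).

Elementary finite-volume identities for the Gibbs measures `μ^η_{Λ;β,h}` of `IsingModel.lean`
(Friedli–Velenik 2017, §3.1, Def. 3.3, Hamiltonian (3.1) over the edges `ℰ^b_Λ` of (3.2)),
all proved by manipulating the finite Boltzmann sums of `integral_isingMeasure`: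

* `sum_isingWeight_fixed_eq_sum_sum`, `isingPartitionFunction_fixed_eq_sum` — the **two-step
  (DLR) decomposition** for `Λ' ⊆ Λ`: summing first over the spins of `Λ ∖ Λ'`, which update the
  boundary condition, and then over the spins of `Λ'` (Friedli–Velenik 2017, Lemma 6.7,
  eqs. (6.5)–(6.10); the spatial Markov property of Exercise 3.11, eq. (3.26));
* `isingExpect_fixed_congr_outerBoundary` — `⟨F⟩^η_Λ` depends on `η` only through `η|_{∂ᵉˣΛ}`
  for `Λ`-local `F` (Friedli–Velenik 2017, §3.6.3, remark after (3.26));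
* `isingExpect_fixed_mul_of_separated`, `isingExpect_fixed_eq_of_separated` — **factorisation
  over edge-separated volumes**: if no edge joins `W₀` to `W ∖ W₀`, then
  `⟨f g⟩^η_W = ⟨f⟩^η_{W₀} ⟨g⟩^η_W` and `⟨g⟩^η_W = ⟨g⟩^η_{W∖W₀}` for `f` (`g`) depending only on
  the spins of `W₀` (`W ∖ W₀`) (the step "fixing all the spins on `∂ᵉˣB(L) ∪ ∂ᵉˣ(i+B(L))` to
  `+1`" in the solution of Friedli–Velenik 2017, Exercise 3.15, App. C);
* `isingMeasure_univ_fixed`, `isingExpect_univ_fixed` — on the whole (finite) vertex set every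
  boundary condition gives the free measure (`ℰ^b_V = ℰ_V`; the torus, Def. 3.2);
* `isingCorr_plus_anti_volume_of_gks` — **`Λ ↦ ⟨σ_A⟩⁺_{Λ;β,h}` is non-increasing** for
  `β, h ≥ 0` on any locally finite graph, granting the tree fact `gks_two` for that graph
  (Friedli–Velenik 2017, Exercise 3.12; proof of Lemma 3.22 with GKS II in place of FKG, via the
  two-step decomposition and the ferromagnetic polynomial `∏_{b ∈ Λ∖Λ'} (1 + σ_b)/2`).

These are the finite-volume inputs of `TorusZeroMode.lean` (the zero-mode bound (3.17) of
Aizenman–Duminil-Copin–Sidoravicius 2015, §3.3). Companion of `IsingMonotonicity.lean` (FKG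
tilts: `isingExpect_plus_anti_volume_of_fkg` is the FKG form of Lemma 3.22 for *nondecreasing*
observables; the GKS form below covers the non-monotone `σ_A`, e.g. `σ_xσ_y`, at `h ≥ 0`), whose
`edgesTouching_mono` is reused.

## Mathlib status

No Ising model in Mathlib. Anchors: `Equiv.sum_comp`, `Fintype.sum_prod_type_right`,
`Finset.prod_one_add` (expansion of `∏ (1 + σ_b)`), `Finset.sum_eq_single`.
-/

noncomputable section

open MeasureTheory Finset Filter Topology
open scoped symmDiff

namespace Literature.Probability.LatticeModels

/-! ### Finite-volume consistency for fixed boundary conditions -/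

section Consistency

variable {V : Type*} (G : SimpleGraph V) [DecidableEq V] [G.LocallyFinite]

/-- An endpoint outside `Λ` of an edge touching `Λ` lies in the outer boundary of `Λ`. [folklore] -/
theorem mem_outerBoundary_of_mem_edgesTouching {Λ : Finset V} {e : Sym2 V}
    (he : e ∈ edgesTouching G Λ) {z : V} (hz : z ∈ e) (hzΛ : z ∉ Λ) :
    z ∈ outerBoundary G Λ := by
  rw [mem_edgesTouching_iff] at he
  obtain ⟨he, x, hx, hxe⟩ := he
  rw [mem_outerBoundary_iff]
  refine ⟨hzΛ, x, hx, ?_⟩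
  have hxz : x ≠ z := fun h => hzΛ (h ▸ hx)
  have : e = s(x, z) := (Sym2.mem_and_mem_iff hxz).1 ⟨hxe, hz⟩
  subst this
  exact ((SimpleGraph.mem_edgeSet G).1 he).symm

/-- **Gluing in two steps.** For `Λ' ⊆ Λ` and a fixed boundary condition `η`, gluing
`τ : Λ → ℤˣ` into `η` is gluing its restriction to `Λ'` into the configuration obtained by
gluing its restriction to `Λ ∖ Λ'` into `η` (Friedli–Velenik 2017, §3.1, `Ω_Λ^η`; this is the
decomposition `ω = ω_Δ ω_{Λ∖Δ} η_{Λᶜ}` of the proof of Lemma 6.7). [cite: FriedliVelenik2017, §3.1] -/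
theorem glue_fixed_eq_glue_glue {Λ' Λ : Finset V} (hsub : Λ' ⊆ Λ) (η : SpinConfig V)
    (τ : Λ → ℤˣ) :
    glue Λ τ (.fixed η) =
      glue Λ' (fun x => τ ⟨x, hsub x.2⟩)
        (.fixed (glue (Λ \ Λ') (fun x => τ ⟨x, (Finset.mem_sdiff.1 x.2).1⟩) (.fixed η))) := by
  funext x
  by_cases hx' : x ∈ Λ'
  · rw [glue_apply_of_mem _ _ _ (hsub hx'), glue_apply_of_mem _ _ _ hx']
  · rw [glue_apply_of_notMem _ _ _ hx', BoundaryCondition.outside_fixed]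
    by_cases hx : x ∈ Λ
    · rw [glue_apply_of_mem _ _ _ hx, glue_apply_of_mem _ _ _ (Finset.mem_sdiff.2 ⟨hx, hx'⟩)]
    · rw [glue_apply_of_notMem _ _ _ hx, glue_apply_of_notMem _ _ _
        (fun h => hx (Finset.mem_sdiff.1 h).1)]

/-- **The Boltzmann weight in two steps** (Friedli–Velenik 2017, proof of Lemma 6.7, eq. (6.10):
`ℋ_Λ - ℋ_Δ` does not depend on the spins in `Δ`; solution of Exercise 3.11, App. C): for
`Λ' ⊆ Λ`, `w^η_{Λ;β,h}(τ) = exp (β (∑_{e ∈ ℰ^b_Λ ∖ ℰ^b_{Λ'}} σ_e(η[τ₂]) + h ∑_{x ∈ Λ∖Λ'} η[τ₂]_x))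
· w^{η[τ₂]}_{Λ';β,h}(τ₁)` where `τ₁, τ₂` are the restrictions of `τ` and `η[τ₂]` is `η`
updated by `τ₂` on `Λ ∖ Λ'`. [cite: FriedliVelenik2017, Lemma 6.7, eq. (6.10)] -/
theorem isingWeight_fixed_eq_mul {Λ' Λ : Finset V} (hsub : Λ' ⊆ Λ) (η : SpinConfig V)
    (β h : ℝ) (τ : Λ → ℤˣ) :
    isingWeight G Λ β h (.fixed η) τ =
      Real.exp (β * (∑ e ∈ edgesTouching G Λ \ edgesTouching G Λ',
          bondSpin (glue (Λ \ Λ') (fun x => τ ⟨x, (Finset.mem_sdiff.1 x.2).1⟩) (.fixed η)) e +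
        h * ∑ x ∈ Λ \ Λ',
          spinAt x (glue (Λ \ Λ') (fun x => τ ⟨x, (Finset.mem_sdiff.1 x.2).1⟩) (.fixed η)))) *
      isingWeight G Λ' β h
        (.fixed (glue (Λ \ Λ') (fun x => τ ⟨x, (Finset.mem_sdiff.1 x.2).1⟩) (.fixed η)))
        (fun x => τ ⟨x, hsub x.2⟩) := by
  set η₂ := glue (Λ \ Λ') (fun x => τ ⟨x, (Finset.mem_sdiff.1 x.2).1⟩) (.fixed η) with hη₂
  set τ₁ : Λ' → ℤˣ := fun x => τ ⟨x, hsub x.2⟩ with hτ₁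
  have hcfg : glue Λ τ (.fixed η) = glue Λ' τ₁ (.fixed η₂) := glue_fixed_eq_glue_glue hsub η τ
  rw [isingWeight, isingWeight, ← Real.exp_add, hcfg]
  congr 1
  set σ := glue Λ' τ₁ (.fixed η₂) with hσ
  -- outside `Λ'` the glued configuration is `η₂`
  have hout : ∀ x, x ∉ Λ' → σ x = η₂ x := fun x hx => by
    rw [hσ, glue_apply_of_notMem _ _ _ hx, BoundaryCondition.outside_fixed]
  have hbond : ∀ e ∈ edgesTouching G Λ \ edgesTouching G Λ', bondSpin σ e = bondSpin η₂ e := by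
    intro e he
    obtain ⟨heΛ, heΛ'⟩ := Finset.mem_sdiff.1 he
    have hends : ∀ z ∈ e, z ∉ Λ' := fun z hz hzΛ' =>
      heΛ' (mem_edgesTouching_iff.2 ⟨(mem_edgesTouching_iff.1 heΛ).1, z, hzΛ', hz⟩)
    induction e using Sym2.ind with
    | _ a b =>
      simp only [bondSpin_mk, spinAt, hout a (hends a (Sym2.mem_mk_left _ _)),
        hout b (hends b (Sym2.mem_mk_right _ _))]
  have hfield : ∀ x ∈ Λ \ Λ', spinAt x σ = spinAt x η₂ := fun x hx => by
    simp only [spinAt, hout x (Finset.mem_sdiff.1 hx).2]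
  have hE : ∑ e ∈ edgesTouching G Λ, bondSpin σ e =
      ∑ e ∈ edgesTouching G Λ', bondSpin σ e +
        ∑ e ∈ edgesTouching G Λ \ edgesTouching G Λ', bondSpin η₂ e := by
    rw [← Finset.sum_sdiff (edgesTouching_mono G hsub), add_comm,
      Finset.sum_congr rfl hbond]
  have hF : ∑ x ∈ Λ, spinAt x σ = ∑ x ∈ Λ', spinAt x σ + ∑ x ∈ Λ \ Λ', spinAt x η₂ := by
    rw [← Finset.sum_sdiff hsub, add_comm, Finset.sum_congr rfl hfield]
  simp only [isingHamiltonian, interactionEdges_fixed, hE, hF]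
  ring

/-- **Finite-volume consistency (DLR) at the level of Boltzmann sums** (Friedli–Velenik 2017,
Lemma 6.7, eq. (6.5): `⟨f⟩^η_Λ = ∑_{ω_{Λ∖Δ}} ⟨f⟩^{ω_{Λ∖Δ}η_{Λᶜ}}_Δ μ^η_Λ(ω_{Λ∖Δ} outside Δ)`, the
spatial Markov property of Exercise 3.11, eq. (3.26); here before normalisation): for
`Λ' ⊆ Λ`, a fixed boundary condition `η` and any `F`,
`∑_τ w^η_Λ(τ) F(τ ∨ η) = ∑_{τ₂} e^{β(…)} ∑_{τ₁} w^{η[τ₂]}_{Λ'}(τ₁) F(τ₁ ∨ η[τ₂])`, summing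
first over the spins `τ₂` of `Λ ∖ Λ'` (which update the boundary condition to `η[τ₂]`) and then
over the spins `τ₁` of `Λ'`. [cite: FriedliVelenik2017, Lemma 6.7, eq. (6.5)] -/
theorem sum_isingWeight_fixed_eq_sum_sum {Λ' Λ : Finset V} (hsub : Λ' ⊆ Λ) (η : SpinConfig V)
    (β h : ℝ) (F : SpinConfig V → ℝ) :
    ∑ τ : Λ → ℤˣ, isingWeight G Λ β h (.fixed η) τ * F (glue Λ τ (.fixed η)) =
      ∑ τ₂ : ↥(Λ \ Λ') → ℤˣ,
        Real.exp (β * (∑ e ∈ edgesTouching G Λ \ edgesTouching G Λ',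
            bondSpin (glue (Λ \ Λ') τ₂ (.fixed η)) e +
          h * ∑ x ∈ Λ \ Λ', spinAt x (glue (Λ \ Λ') τ₂ (.fixed η)))) *
        ∑ τ₁ : Λ' → ℤˣ, isingWeight G Λ' β h (.fixed (glue (Λ \ Λ') τ₂ (.fixed η))) τ₁ *
          F (glue Λ' τ₁ (.fixed (glue (Λ \ Λ') τ₂ (.fixed η)))) := by
  classical
  -- restriction maps and the splitting equivalence
  let r₁ : (Λ → ℤˣ) → (Λ' → ℤˣ) := fun τ x => τ ⟨x, hsub x.2⟩
  let r₂ : (Λ → ℤˣ) → (↥(Λ \ Λ') → ℤˣ) := fun τ x => τ ⟨x, (Finset.mem_sdiff.1 x.2).1⟩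
  let eqv : (Λ → ℤˣ) ≃ (Λ' → ℤˣ) × (↥(Λ \ Λ') → ℤˣ) :=
    { toFun := fun τ => (r₁ τ, r₂ τ)
      invFun := fun p x => if hx : (x : V) ∈ Λ' then p.1 ⟨x, hx⟩
        else p.2 ⟨x, Finset.mem_sdiff.2 ⟨x.2, hx⟩⟩
      left_inv := fun τ => by
        funext x
        by_cases hx : (x : V) ∈ Λ' <;> simp [r₁, r₂, hx]
      right_inv := fun p => by
        ext x
        · simp [r₁, x.2]
        · have hx : (x : V) ∉ Λ' := (Finset.mem_sdiff.1 x.2).2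
          simp [r₂, hx] }
  rw [← Equiv.sum_comp eqv.symm, Fintype.sum_prod_type_right]
  refine Finset.sum_congr rfl fun τ₂ _ => ?_
  rw [Finset.mul_sum]
  refine Finset.sum_congr rfl fun τ₁ _ => ?_
  have h1 : r₁ (eqv.symm (τ₁, τ₂)) = τ₁ := congrArg Prod.fst (eqv.apply_symm_apply (τ₁, τ₂))
  have h2 : r₂ (eqv.symm (τ₁, τ₂)) = τ₂ := congrArg Prod.snd (eqv.apply_symm_apply (τ₁, τ₂))
  have hw := isingWeight_fixed_eq_mul G hsub η β h (eqv.symm (τ₁, τ₂))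
  have hc := glue_fixed_eq_glue_glue hsub η (eqv.symm (τ₁, τ₂))
  change isingWeight G Λ β h (.fixed η) (eqv.symm (τ₁, τ₂)) =
    Real.exp (β * (∑ e ∈ edgesTouching G Λ \ edgesTouching G Λ',
        bondSpin (glue (Λ \ Λ') (r₂ (eqv.symm (τ₁, τ₂))) (.fixed η)) e +
      h * ∑ x ∈ Λ \ Λ', spinAt x (glue (Λ \ Λ') (r₂ (eqv.symm (τ₁, τ₂))) (.fixed η)))) *
    isingWeight G Λ' β h (.fixed (glue (Λ \ Λ') (r₂ (eqv.symm (τ₁, τ₂))) (.fixed η)))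
      (r₁ (eqv.symm (τ₁, τ₂))) at hw
  change glue Λ (eqv.symm (τ₁, τ₂)) (.fixed η) =
    glue Λ' (r₁ (eqv.symm (τ₁, τ₂))) (.fixed (glue (Λ \ Λ') (r₂ (eqv.symm (τ₁, τ₂))) (.fixed η))) at hc
  rw [h1, h2] at hw hc
  rw [hw, hc]
  ring

/-- **The partition function in two steps**: `Z^η_Λ = ∑_{τ₂} e^{β(…)} Z^{η[τ₂]}_{Λ'}` for
`Λ' ⊆ Λ` (Friedli–Velenik 2017, proof of Lemma 6.7; solution of Exercise 3.11, App. C: "the same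
decomposition can be used for the partition functions"). [cite: FriedliVelenik2017, Lemma 6.7, eq. (6.5)] -/
theorem isingPartitionFunction_fixed_eq_sum {Λ' Λ : Finset V} (hsub : Λ' ⊆ Λ)
    (η : SpinConfig V) (β h : ℝ) :
    isingPartitionFunction G Λ β h (.fixed η) =
      ∑ τ₂ : ↥(Λ \ Λ') → ℤˣ,
        Real.exp (β * (∑ e ∈ edgesTouching G Λ \ edgesTouching G Λ',
            bondSpin (glue (Λ \ Λ') τ₂ (.fixed η)) e +
          h * ∑ x ∈ Λ \ Λ', spinAt x (glue (Λ \ Λ') τ₂ (.fixed η)))) *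
        isingPartitionFunction G Λ' β h (.fixed (glue (Λ \ Λ') τ₂ (.fixed η))) := by
  have := sum_isingWeight_fixed_eq_sum_sum G hsub η β h (fun _ => 1)
  simp only [mul_one] at this
  simpa only [isingPartitionFunction] using this

/-! ### Locality in the boundary condition -/

/-- The Boltzmann weight `w^η_Λ(τ)` depends on `η` only through its values on the outer
boundary `∂ᵉˣΛ` (Friedli–Velenik 2017, §3.1, eqs. (3.1)–(3.2): `ℋ_Λ` involves only the edges of
`ℰ^b_Λ`; §3.6.3, remark after eq. (3.26)). [cite: FriedliVelenik2017, §3.6.3, eq. (3.26)] -/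
theorem isingWeight_fixed_congr_outerBoundary {Λ : Finset V} {η η' : SpinConfig V}
    (hη : ∀ y ∈ outerBoundary G Λ, η y = η' y) (β h : ℝ) (τ : Λ → ℤˣ) :
    isingWeight G Λ β h (.fixed η) τ = isingWeight G Λ β h (.fixed η') τ := by
  have hin : ∀ x ∈ Λ, glue Λ τ (.fixed η) x = glue Λ τ (.fixed η') x := fun x hx => by
    rw [glue_apply_of_mem _ _ _ hx, glue_apply_of_mem _ _ _ hx]
  have hbd : ∀ y ∈ outerBoundary G Λ, glue Λ τ (.fixed η) y = glue Λ τ (.fixed η') y := by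
    intro y hy
    have hyΛ : y ∉ Λ := (mem_outerBoundary_iff.1 hy).1
    rw [glue_apply_of_notMem _ _ _ hyΛ, glue_apply_of_notMem _ _ _ hyΛ,
      BoundaryCondition.outside_fixed, BoundaryCondition.outside_fixed, hη y hy]
  have hpt : ∀ e ∈ edgesTouching G Λ, ∀ z ∈ e,
      glue Λ τ (.fixed η) z = glue Λ τ (.fixed η') z := fun e he z hz => by
    by_cases hzΛ : z ∈ Λ
    · exact hin z hzΛ
    · exact hbd z (mem_outerBoundary_of_mem_edgesTouching G he hz hzΛ)
  have hE : ∑ e ∈ edgesTouching G Λ, bondSpin (glue Λ τ (.fixed η)) e =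
      ∑ e ∈ edgesTouching G Λ, bondSpin (glue Λ τ (.fixed η')) e := by
    refine Finset.sum_congr rfl fun e he => ?_
    induction e using Sym2.ind with
    | _ a b =>
      simp only [bondSpin_mk, spinAt, hpt _ he a (Sym2.mem_mk_left _ _),
        hpt _ he b (Sym2.mem_mk_right _ _)]
  have hF : ∑ x ∈ Λ, spinAt x (glue Λ τ (.fixed η)) = ∑ x ∈ Λ, spinAt x (glue Λ τ (.fixed η')) :=
    Finset.sum_congr rfl fun x hx => by simp only [spinAt, hin x hx]
  simp only [isingWeight, isingHamiltonian, interactionEdges_fixed, hE, hF]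

/-- The partition function `Z^η_Λ` depends on `η` only through `η|_{∂ᵉˣΛ}`
(Friedli–Velenik 2017, §3.6.3, remark after eq. (3.26)). [cite: FriedliVelenik2017, §3.6.3, eq. (3.26)] -/
theorem isingPartitionFunction_fixed_congr_outerBoundary {Λ : Finset V} {η η' : SpinConfig V}
    (hη : ∀ y ∈ outerBoundary G Λ, η y = η' y) (β h : ℝ) :
    isingPartitionFunction G Λ β h (.fixed η) = isingPartitionFunction G Λ β h (.fixed η') :=
  Finset.sum_congr rfl fun τ _ => isingWeight_fixed_congr_outerBoundary G hη β h τ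

/-- **Locality of `⟨F⟩^η_Λ` in the boundary condition**: for an observable `F` depending only
on the spins in `Λ`, the expectation `⟨F⟩^η_{Λ;β,h}` depends on `η` only through `η|_{∂ᵉˣΛ}`
(Friedli–Velenik 2017, §3.6.3, remark after eq. (3.26): "the probability … really only depends on
`ω'_i` for `i ∈ ∂ᵉˣΔ`"). [cite: FriedliVelenik2017, §3.6.3, eq. (3.26)] -/
theorem isingExpect_fixed_congr_outerBoundary {Λ : Finset V} {η η' : SpinConfig V}
    (hη : ∀ y ∈ outerBoundary G Λ, η y = η' y) (β h : ℝ) {F : SpinConfig V → ℝ}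
    (hFm : Measurable F) (hF : ∀ σ σ' : SpinConfig V, (∀ x ∈ Λ, σ x = σ' x) → F σ = F σ') :
    isingExpect G Λ β h (.fixed η) F = isingExpect G Λ β h (.fixed η') F := by
  rw [isingExpect_eq_sum_div G Λ h _ β hFm, isingExpect_eq_sum_div G Λ h _ β hFm,
    isingPartitionFunction_fixed_congr_outerBoundary G hη β h]
  congr 1
  refine Finset.sum_congr rfl fun τ _ => ?_
  rw [isingWeight_fixed_congr_outerBoundary G hη β h τ,
    hF _ (glue Λ τ (.fixed η')) fun x hx => by
      rw [glue_apply_of_mem _ _ _ hx, glue_apply_of_mem _ _ _ hx]]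

end Consistency

end Literature.Probability.LatticeModels

namespace Literature.Probability.LatticeModels

section Factorisation

variable {V : Type*} (G : SimpleGraph V) [DecidableEq V] [G.LocallyFinite]

/-- **DLR in two steps, packaged**: for `Λ' ⊆ Λ` and a fixed boundary condition `η` there are
positive numbers `R(τ₂)` (the Boltzmann factors of the bonds and sites of `Λ ∖ Λ'` not seen
from `Λ'`) with `∑_τ w^η_Λ(τ) F(τ ∨ η) = ∑_{τ₂} R(τ₂) ∑_{τ₁} w^{η[τ₂]}_{Λ'}(τ₁) F(τ₁ ∨ η[τ₂])`
for every `F` (Friedli–Velenik 2017, Lemma 6.7, eq. (6.5)). [cite: FriedliVelenik2017, Lemma 6.7, eq. (6.5)] -/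
theorem exists_sum_isingWeight_fixed_eq {Λ' Λ : Finset V} (hsub : Λ' ⊆ Λ) (η : SpinConfig V)
    (β h : ℝ) :
    ∃ R : (↥(Λ \ Λ') → ℤˣ) → ℝ, (∀ τ₂, 0 < R τ₂) ∧ ∀ F : SpinConfig V → ℝ,
      ∑ τ : Λ → ℤˣ, isingWeight G Λ β h (.fixed η) τ * F (glue Λ τ (.fixed η)) =
        ∑ τ₂ : ↥(Λ \ Λ') → ℤˣ, R τ₂ *
          ∑ τ₁ : Λ' → ℤˣ, isingWeight G Λ' β h (.fixed (glue (Λ \ Λ') τ₂ (.fixed η))) τ₁ *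
            F (glue Λ' τ₁ (.fixed (glue (Λ \ Λ') τ₂ (.fixed η)))) :=
  ⟨_, fun _ => Real.exp_pos _, sum_isingWeight_fixed_eq_sum_sum G hsub η β h⟩

/-- **Splitting of the Boltzmann sums over edge-separated volumes.** If `W₀ ⊆ W` and no edge
joins `W₀` to `W ∖ W₀`, then for `f` depending only on the spins in `W₀` and `g` depending only
on the spins in `W ∖ W₀`,
`∑_τ w^η_W(τ) (f g)(τ ∨ η) = (∑_{τ₂} R(τ₂) g(η[τ₂])) · ∑_{τ₁} w^η_{W₀}(τ₁) f(τ₁ ∨ η)`: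
the Hamiltonian `ℋ_W` (Friedli–Velenik 2017, §3.1, eq. (3.1)) is the sum of `ℋ_{W₀}` and of a
term not involving the spins of `W₀`; this is the step "fixing all the spins on
`∂ᵉˣB(L) ∪ ∂ᵉˣ(i + B(L))` to `+1`" of the solution of Exercise 3.15 (App. C). [cite: FriedliVelenik2017, Exercise 3.15 (solution, App. C)] -/
theorem exists_sum_isingWeight_fixed_mul_eq {W₀ W : Finset V} (hsub : W₀ ⊆ W)
    (hsep : ∀ x ∈ W₀, ∀ y ∈ W \ W₀, ¬G.Adj x y) (η : SpinConfig V) (β h : ℝ) :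
    ∃ R : (↥(W \ W₀) → ℤˣ) → ℝ, (∀ τ₂, 0 < R τ₂) ∧ ∀ f g : SpinConfig V → ℝ,
      (∀ σ σ' : SpinConfig V, (∀ x ∈ W₀, σ x = σ' x) → f σ = f σ') →
      (∀ σ σ' : SpinConfig V, (∀ x ∈ W \ W₀, σ x = σ' x) → g σ = g σ') →
      ∑ τ : W → ℤˣ, isingWeight G W β h (.fixed η) τ *
          (f (glue W τ (.fixed η)) * g (glue W τ (.fixed η))) =
        (∑ τ₂ : ↥(W \ W₀) → ℤˣ, R τ₂ * g (glue (W \ W₀) τ₂ (.fixed η))) *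
          ∑ τ₁ : W₀ → ℤˣ, isingWeight G W₀ β h (.fixed η) τ₁ * f (glue W₀ τ₁ (.fixed η)) := by
  obtain ⟨R, hRpos, hR⟩ := exists_sum_isingWeight_fixed_eq G hsub η β h
  refine ⟨R, hRpos, fun f g hf hg => ?_⟩
  rw [hR (fun σ => f σ * g σ), Finset.sum_mul]
  refine Finset.sum_congr rfl fun τ₂ _ => ?_
  set η₂ := glue (W \ W₀) τ₂ (.fixed η) with hη₂
  -- the boundary conditions `η₂` and `η` agree on the outer boundary of `W₀`
  have hbd : ∀ y ∈ outerBoundary G W₀, η₂ y = η y := by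
    intro y hy
    obtain ⟨hyW₀, x, hx, hyx⟩ := mem_outerBoundary_iff.1 hy
    have hy' : y ∉ W \ W₀ := fun hyD => hsep x hx y hyD hyx.symm
    rw [hη₂, glue_apply_of_notMem _ _ _ hy', BoundaryCondition.outside_fixed]
  rw [mul_assoc]
  congr 1
  rw [Finset.mul_sum]
  refine Finset.sum_congr rfl fun τ₁ _ => ?_
  have hfv : f (glue W₀ τ₁ (.fixed η₂)) = f (glue W₀ τ₁ (.fixed η)) :=
    hf _ _ fun x hx => by rw [glue_apply_of_mem _ _ _ hx, glue_apply_of_mem _ _ _ hx]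
  have hgv : g (glue W₀ τ₁ (.fixed η₂)) = g η₂ :=
    hg _ _ fun x hx => by
      rw [glue_apply_of_notMem _ _ _ (Finset.mem_sdiff.1 hx).2, BoundaryCondition.outside_fixed]
  rw [isingWeight_fixed_congr_outerBoundary G hbd β h τ₁, hfv, hgv]
  ring

/-- **Independence of edge-separated volumes under a fixed boundary condition**
(Friedli–Velenik 2017, solution of Exercise 3.15, App. C: with the spins on
`∂ᵉˣB(L) ∪ ∂ᵉˣ(i + B(L))` fixed, `⟨n_A n_{B+i}⟩ = ⟨n_A⟩⁺_{B(L)} ⟨n_{B+i}⟩⁺_{i+B(L)}`): if `W₀ ⊆ W`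
and no edge of `G` joins `W₀` to `W ∖ W₀`, then for measurable `f` depending only on the spins in
`W₀` and measurable `g` depending only on the spins in `W ∖ W₀`,
`⟨f g⟩^η_{W;β,h} = ⟨f⟩^η_{W₀;β,h} ⟨g⟩^η_{W;β,h}`. [cite: FriedliVelenik2017, Exercise 3.15 (solution, App. C)] -/
theorem isingExpect_fixed_mul_of_separated {W₀ W : Finset V} (hsub : W₀ ⊆ W)
    (hsep : ∀ x ∈ W₀, ∀ y ∈ W \ W₀, ¬G.Adj x y) (η : SpinConfig V) (β h : ℝ)
    {f g : SpinConfig V → ℝ} (hfm : Measurable f) (hgm : Measurable g)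
    (hf : ∀ σ σ' : SpinConfig V, (∀ x ∈ W₀, σ x = σ' x) → f σ = f σ')
    (hg : ∀ σ σ' : SpinConfig V, (∀ x ∈ W \ W₀, σ x = σ' x) → g σ = g σ') :
    isingExpect G W β h (.fixed η) (fun σ => f σ * g σ) =
      isingExpect G W₀ β h (.fixed η) f * isingExpect G W β h (.fixed η) g := by
  obtain ⟨R, hRpos, hR⟩ := exists_sum_isingWeight_fixed_mul_eq G hsub hsep η β h
  have hone : ∀ σ σ' : SpinConfig V, (fun _ : SpinConfig V => (1 : ℝ)) σ = (fun _ => (1 : ℝ)) σ' :=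
    fun _ _ => rfl
  have hfg := hR f g hf hg
  have hg1 := hR (fun _ => 1) g (fun σ σ' _ => hone σ σ') hg
  have h11 := hR (fun _ => 1) (fun _ => 1) (fun σ σ' _ => hone σ σ') (fun σ σ' _ => hone σ σ')
  simp only [one_mul, mul_one] at hg1 h11
  -- names for the four sums
  set Gs := ∑ τ₂ : ↥(W \ W₀) → ℤˣ, R τ₂ * g (glue (W \ W₀) τ₂ (.fixed η)) with hGs
  set Rs := ∑ τ₂ : ↥(W \ W₀) → ℤˣ, R τ₂ with hRs
  set Fs := ∑ τ₁ : W₀ → ℤˣ, isingWeight G W₀ β h (.fixed η) τ₁ * f (glue W₀ τ₁ (.fixed η))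
    with hFs
  have hZ₀ : isingPartitionFunction G W₀ β h (.fixed η) =
      ∑ τ₁ : W₀ → ℤˣ, isingWeight G W₀ β h (.fixed η) τ₁ := rfl
  have hZ : isingPartitionFunction G W β h (.fixed η) = Rs * isingPartitionFunction G W₀ β h (.fixed η) := by
    rw [hZ₀, ← h11]; rfl
  have hZ₀pos := isingPartitionFunction_pos G W₀ β h (.fixed η)
  have hRs_pos : 0 < Rs := Finset.sum_pos (fun τ₂ _ => hRpos τ₂) Finset.univ_nonempty
  rw [isingExpect_eq_sum_div G W h _ β (show Measurable (fun σ => f σ * g σ) from hfm.mul hgm),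
    isingExpect_eq_sum_div G W₀ h _ β hfm, isingExpect_eq_sum_div G W h _ β hgm]
  change (∑ τ : W → ℤˣ, isingWeight G W β h (.fixed η) τ *
      (f (glue W τ (.fixed η)) * g (glue W τ (.fixed η)))) / _ = _
  rw [hfg, hg1, hZ, ← hFs, hZ₀]
  field_simp

/-- **Restriction to an edge-separated sub-volume**: under the hypotheses of
`isingExpect_fixed_mul_of_separated`, `⟨f⟩^η_{W;β,h} = ⟨f⟩^η_{W₀;β,h}` for measurable `f`
depending only on the spins in `W₀` (Friedli–Velenik 2017, solution of Exercise 3.15, App. C). [cite: FriedliVelenik2017, Exercise 3.15 (solution, App. C)] -/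
theorem isingExpect_fixed_eq_of_separated {W₀ W : Finset V} (hsub : W₀ ⊆ W)
    (hsep : ∀ x ∈ W₀, ∀ y ∈ W \ W₀, ¬G.Adj x y) (η : SpinConfig V) (β h : ℝ)
    {f : SpinConfig V → ℝ} (hfm : Measurable f)
    (hf : ∀ σ σ' : SpinConfig V, (∀ x ∈ W₀, σ x = σ' x) → f σ = f σ') :
    isingExpect G W β h (.fixed η) f = isingExpect G W₀ β h (.fixed η) f := by
  have h := isingExpect_fixed_mul_of_separated G hsub hsep η β h hfm measurable_const hf
    (g := fun _ => 1) (fun _ _ _ => rfl)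
  simp only [mul_one] at h
  rw [h, isingExpect_const, mul_one]

end Factorisation

/-! ### The whole vertex set: fixed and free boundary conditions agree -/

section Univ

variable {V : Type*} [Fintype V] (G : SimpleGraph V) [DecidableEq V] [G.LocallyFinite]

omit [DecidableEq V] [G.LocallyFinite] in
/-- On the whole (finite) vertex set every boundary condition gives the same glued
configuration. [folklore] -/
theorem glue_univ (τ : ↥(Finset.univ : Finset V) → ℤˣ) (bc bc' : BoundaryCondition V) :
    glue Finset.univ τ bc = glue Finset.univ τ bc' := by
  funext x
  rw [glue_apply_of_mem _ _ _ (Finset.mem_univ x), glue_apply_of_mem _ _ _ (Finset.mem_univ x)]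

/-- On the whole vertex set, `ℰ^b_V = ℰ_V`. [folklore] -/
theorem edgesTouching_univ : edgesTouching G (Finset.univ : Finset V) = edgesIn G Finset.univ := by
  ext e
  simp only [mem_edgesTouching_iff, mem_edgesIn_iff, Finset.mem_univ, true_and, implies_true,
    and_true, and_iff_left_iff_imp]
  intro _
  induction e using Sym2.ind with
  | _ a b => exact ⟨a, Sym2.mem_mk_left a b⟩

/-- **On the whole finite vertex set the finite-volume Gibbs measure does not depend on the
boundary condition**: `μ^η_{V;β,h} = μ^∅_{V;β,h}` (no edge leaves `V`; Friedli–Velenik 2017,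
§3.1, eq. (3.2): `ℰ^b_Λ = ℰ_Λ` when `Λ` is the whole graph, as for the torus, Def. 3.2). [cite: FriedliVelenik2017, §3.1, Def. 3.2] -/
theorem isingMeasure_univ_fixed (β h : ℝ) (η : SpinConfig V) :
    isingMeasure G Finset.univ β h (.fixed η) = isingMeasure G Finset.univ β h .free := by
  have href : isingRef (Finset.univ : Finset V) (.fixed η) = isingRef Finset.univ .free := by
    unfold isingRef
    congr 1
    funext τ
    exact glue_univ τ _ _
  have hH : isingHamiltonian G Finset.univ h (.fixed η) = isingHamiltonian G Finset.univ h .free := by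
    funext σ
    simp only [isingHamiltonian, interactionEdges_fixed, interactionEdges_free, edgesTouching_univ]
  unfold isingMeasure
  rw [href, hH]

/-- `⟨f⟩^η_{V;β,h} = ⟨f⟩^∅_{V;β,h}` on the whole finite vertex set. [cite: FriedliVelenik2017, §3.1, Def. 3.2] -/
theorem isingExpect_univ_fixed (β h : ℝ) (η : SpinConfig V) (f : SpinConfig V → ℝ) :
    isingExpect G Finset.univ β h (.fixed η) f = isingExpect G Finset.univ β h .free f := by
  simp only [isingExpect, isingMeasure_univ_fixed]

end Univ

end Literature.Probability.LatticeModels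

namespace Literature.Probability.LatticeModels

open Percolation

section PlusVolume

variable {V : Type*} [DecidableEq V] (G : SimpleGraph V) [G.LocallyFinite]

/-- **`+` correlations are non-increasing in the volume, from GKS II** (Friedli–Velenik 2017,
Exercise 3.12: "Using the GKS inequalities, prove that, for all `β, h ≥ 0`,
`⟨σ_A⟩⁺_{Λ₁;β,h} ≥ ⟨σ_A⟩⁺_{Λ₂;β,h}` … for all `A ⊆ Λ₁ ⊆ Λ₂`"; Lemma 3.22, eq. (3.25) is the FKG
version), for the Ising model on **any** locally finite graph, `β ≥ 0`, `h ≥ 0`, granting the tree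
fact `gks_two` for `G`. Proof: with `D = Λ ∖ Λ'` and the ferromagnetic polynomial
`W = ∏_{b ∈ D} (1 + σ_b)/2 = 2^{-|D|} ∑_{S ⊆ D} σ_S` (the indicator of `σ|_D ≡ +`), the
finite-volume DLR identity gives `⟨σ_A W⟩⁺_Λ = ⟨W⟩⁺_Λ ⟨σ_A⟩⁺_{Λ'}`, while GKS II gives
`⟨σ_A⟩⁺_Λ ⟨W⟩⁺_Λ ≤ ⟨σ_A W⟩⁺_Λ` (the proof of Lemma 3.22 with GKS II in place of FKG). [cite: FriedliVelenik2017, Exercise 3.12] -/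
theorem isingCorr_plus_anti_volume_of_gks
    (hgks : ∀ (Λ A B : Finset V) (β h : ℝ) (bc : BoundaryCondition V),
      gks_two G (Λ := Λ) (A := A) (B := B) (β := β) (h := h) (bc := bc))
    {β h : ℝ} (hβ : 0 ≤ β) (hh : 0 ≤ h) {Λ' Λ A : Finset V} (hA : A ⊆ Λ') (hsub : Λ' ⊆ Λ) :
    isingCorr G Λ β h .plus A ≤ isingCorr G Λ' β h .plus A := by
  classical
  set D := Λ \ Λ' with hD
  -- the conditioning polynomial `W = 2^{-|D|} ∑_{S ⊆ D} σ_S = ∏_{b ∈ D} (1 + σ_b)/2`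
  set c : ℝ := (1 / 2) ^ #D with hc
  have hc_pos : 0 < c := by positivity
  set W : SpinConfig V → ℝ := fun σ => ∑ t ∈ D.powerset, c * spinProduct t σ with hW
  have hWprod : ∀ σ, W σ = c * ∏ b ∈ D, (1 + spinAt b σ) := fun σ => by
    simp only [hW, ← Finset.mul_sum, Finset.prod_one_add, spinProduct]
  have hWm : Measurable W :=
    Finset.measurable_sum _ fun t _ => (measurable_spinProduct t).const_mul c
  -- value of `W` on a configuration whose restriction to `D` is `τ₂`
  have hWval : ∀ (τ₂ : ↥D → ℤˣ) (σ : SpinConfig V), (∀ b (hb : b ∈ D), σ b = τ₂ ⟨b, hb⟩) →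
      W σ = if τ₂ = 1 then 1 else 0 := by
    intro τ₂ σ hσ
    rw [hWprod]
    split_ifs with h1
    · have : ∀ b ∈ D, (1 + spinAt b σ) = 2 := fun b hb => by
        rw [spinAt, hσ b hb, h1]; norm_num
      rw [Finset.prod_congr rfl this, Finset.prod_const, hc]
      rw [← mul_pow]; norm_num
    · obtain ⟨b, hb⟩ : ∃ b : ↥D, τ₂ b ≠ 1 := by
        by_contra hall
        push Not at hall
        exact h1 (funext hall)
      have hm1 : τ₂ b = -1 := (Int.units_eq_one_or (τ₂ b)).resolve_left hb
      have hzero : (1 + spinAt (b : V) σ) = 0 := by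
        rw [spinAt, hσ b b.2]
        simp [hm1]
      rw [Finset.prod_eq_zero b.2 hzero, mul_zero]
  -- the DLR identity for `Λ' ⊆ Λ`, `η = +`
  obtain ⟨R, hRpos, hR⟩ :=
    exists_sum_isingWeight_fixed_eq G hsub (1 : SpinConfig V) β h
  have hplus1 : glue D (1 : ↥D → ℤˣ) (.fixed (1 : SpinConfig V)) = 1 := by
    funext x
    by_cases hx : x ∈ D
    · rw [glue_apply_of_mem _ _ _ hx]; rfl
    · rw [glue_apply_of_notMem _ _ _ hx]; rfl
  -- evaluation of the two Boltzmann sums `∑ w (σ_A W)` and `∑ w W`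
  have hsumF : ∀ F : SpinConfig V → ℝ,
      ∑ τ : Λ → ℤˣ, isingWeight G Λ β h .plus τ * (F (glue Λ τ .plus) * W (glue Λ τ .plus)) =
        R 1 * ∑ τ₁ : Λ' → ℤˣ, isingWeight G Λ' β h .plus τ₁ * F (glue Λ' τ₁ .plus) := by
    intro F
    have key := hR (fun σ => F σ * W σ)
    change ∑ τ : Λ → ℤˣ, isingWeight G Λ β h .plus τ * (F (glue Λ τ .plus) * W (glue Λ τ .plus)) = _
      at key
    rw [key, Finset.sum_eq_single (1 : ↥D → ℤˣ)]
    · rw [hplus1]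
      congr 1
      refine Finset.sum_congr rfl fun τ₁ _ => ?_
      rw [hWval 1 _ (fun b hb => ?_), if_pos rfl, mul_one]
      · rfl
      · rw [glue_apply_of_notMem _ _ _ (Finset.mem_sdiff.1 hb).2]
        rfl
    · intro τ₂ _ hτ₂
      rw [Finset.sum_eq_zero, mul_zero]
      intro τ₁ _
      rw [hWval τ₂ _ (fun b hb => ?_), if_neg hτ₂, mul_zero, mul_zero]
      rw [glue_apply_of_notMem _ _ _ (Finset.mem_sdiff.1 hb).2, BoundaryCondition.outside_fixed,
        glue_apply_of_mem _ _ _ hb]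
    · intro h1; exact absurd (Finset.mem_univ _) h1
  have hSAW := hsumF (spinProduct A)
  have hSW := hsumF (fun _ => 1)
  simp only [one_mul] at hSW
  -- translate into expectations
  have hZ := isingPartitionFunction_pos G Λ β h .plus
  have hZ' := isingPartitionFunction_pos G Λ' β h .plus
  have hEW : isingExpect G Λ β h .plus W = R 1 * isingPartitionFunction G Λ' β h .plus /
      isingPartitionFunction G Λ β h .plus := by
    rw [isingExpect_eq_sum_div G Λ h _ β hWm, hSW]
    simp only [mul_one]
    rfl
  have hEW_pos : 0 < isingExpect G Λ β h .plus W := by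
    rw [hEW]; exact div_pos (mul_pos (hRpos 1) hZ') hZ
  have hEAW : isingExpect G Λ β h .plus (fun σ => spinProduct A σ * W σ) =
      isingExpect G Λ β h .plus W * isingCorr G Λ' β h .plus A := by
    rw [isingExpect_eq_sum_div G Λ h _ β
        (show Measurable (fun σ => spinProduct A σ * W σ) from (measurable_spinProduct A).mul hWm),
      hEW, isingCorr, isingExpect_eq_sum_div G Λ' h _ β (measurable_spinProduct A)]
    rw [hSAW]
    field_simp
  -- GKS II
  have hgks' : isingCorr G Λ β h .plus A * isingExpect G Λ β h .plus W ≤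
      isingExpect G Λ β h .plus (fun σ => spinProduct A σ * W σ) :=
    isingCorr_mul_isingExpect_sum_le G hgks hβ hh (Or.inr rfl) (hA.trans hsub) D.powerset
      (fun _ => c) (fun t => t) (fun _ _ => hc_pos.le)
      (fun t ht => (Finset.mem_powerset.1 ht).trans Finset.sdiff_subset)
  rw [hEAW, mul_comm] at hgks'
  exact le_of_mul_le_mul_left hgks' hEW_pos

/-- Restated: `Λ₁ ⊆ Λ₂ ⇒ ⟨σ_A⟩⁺_{Λ₂;β,h} ≤ ⟨σ_A⟩⁺_{Λ₁;β,h}` for `A ⊆ Λ₁`, i.e.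
`Λ ↦ ⟨σ_A⟩⁺_Λ` is antitone on the volumes containing `A` (Friedli–Velenik 2017, Exercise 3.12;
Lemma 3.22, eq. (3.25)). [cite: FriedliVelenik2017, Exercise 3.12] -/
theorem isingCorr_plus_antitone_of_gks
    (hgks : ∀ (Λ A B : Finset V) (β h : ℝ) (bc : BoundaryCondition V),
      gks_two G (Λ := Λ) (A := A) (B := B) (β := β) (h := h) (bc := bc))
    {β h : ℝ} (hβ : 0 ≤ β) (hh : 0 ≤ h) (A : Finset V) :
    ∀ ⦃Λ₁ Λ₂ : Finset V⦄, A ⊆ Λ₁ → Λ₁ ⊆ Λ₂ →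
      isingCorr G Λ₂ β h .plus A ≤ isingCorr G Λ₁ β h .plus A :=
  fun _ _ hA h12 => isingCorr_plus_anti_volume_of_gks G hgks hβ hh hA h12

end PlusVolume

end Literature.Probability.LatticeModels
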